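import Mathlib

/-!
# The class `h ≤ k` ("K-dominant petals"): the additive three-coin bound for two petals

Normalised (RES0′) model (files `…SunflowerPhiZero*`): masses `ε_Y ∈ (0,1)`, `ε_g, ε_h ≥ 0`, `c = 1 − ε_Y − ε_g − ε_h ≥ 0`,
leverage `κ ∈ [0,1]`; a petal has Ȳ-usage `x`, k-usage `k ≥ z ≥ 1` (g-usage `z`), h-usage `r ≥ 1`, value
`V = c + ε_Y x + ε_g z + ε_h r`.  The petal is K-DOMINANT (`h ≤ k` in the model, i.e. `r ≤ κ k`, here in the weaker form
`r − 1 ≤ κ(k − 1)`) and Ȳ-COVERED (`(ε_g + κε_h)(k − 1) ≤ (1 − ε_Y)(x − 1)`, the model tying (A) = leaf-leaf constant, cf.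
`model_tying_A`).  CONJECTURE H_K (prove-1 g54 memo §7(g)(xii); 0 violations in 860k sampled families, increments monotone in the
`s^k/e`-order): for every family of such petals `∏ V_j ≤ 1 + ε_Y(X−1) + ε_g(K−1) + ε_h(R−1)` (additive potential, no pot, no bank).
This file proves the two-petal case `classK_pair` — with NO tying `θ` and no cap: after raising `z` to `k` it is the statement that the
3-coin merge defect of two class petals is nonpositive, i.e. the bilinear form
`B = (1−ε_Y)a₁a₂/ε_Y + ε_g(1−ε_g)q₁q₂ + ε_h(1−ε_h)ρ₁ρ₂ − ε_g(a₁q₂+a₂q₁) − ε_h(a₁ρ₂+a₂ρ₁) − ε_gε_h(q₁ρ₂+q₂ρ₁) ≥ 0`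
(`a = ε_Y(x−1)`, `q = k−1`, `ρ = r−1`); proof: `B` is affine in each `a_j` with slope `≥ 0`, so reduce to the minimal cover
`(1−ε_Y)a_j = ε_Y(ε_g+κε_h)q_j`, where it becomes a bilinear form in `(ρ₁,ρ₂) ∈ [0,κq₁]×[0,κq₂]` whose four corner values are
`α = ε_Y(λ−ε_g)² + ε_g(1−ε_Y−ε_g)`, `α − κγ = ε_g(1−ε_Y−ε_g−κε_h)` (twice) and `C = (1−ε_Y)(ε_g+κ²ε_h) − λ² ≥ ε_gε_h(1−κ)² ≥ 0`
(`λ = ε_g + κε_h`).  [this work]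
-/

namespace Summit.CriticalPhenomena.PercolationContinuityZ3.Theorems.SunflowerPartition.SafeCalc.LinkedCurrency

/-- An affine function on `[0, T]` is bounded below by the smaller endpoint value (used twice for the corner argument). -/
theorem affine_ge_min_endpoints {m b t T : ℝ} (ht0 : 0 ≤ t) (htT : t ≤ T) :
    min b (b + m * T) ≤ b + m * t := by
  rcases le_total 0 m with hm | hm
  · exact (min_le_left _ _).trans (by nlinarith)
  · exact (min_le_right _ _).trans (by nlinarith)

/-- **The reduced form at minimal cover.**  For `ε_Y ∈ (0,1)`, `ε_g, ε_h ≥ 0`, `ε_Y + ε_g + ε_h ≤ 1`, `κ ∈ [0,1]`, `λ = ε_g + κε_h`,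
`q₁, q₂ ≥ 0` and `ρ_j ∈ [0, κ q_j]`:
`F := [ε_Yλ(λ−2ε_g) + (1−ε_Y)ε_g(1−ε_g)]·q₁q₂ + (1−ε_Y)ε_h(1−ε_h)·ρ₁ρ₂ − ε_h(ε_Yλ + (1−ε_Y)ε_g)·(q₁ρ₂ + q₂ρ₁) ≥ 0`. [this work] -/
theorem classK_reduced_nonneg {εY εg εh κ q₁ q₂ ρ₁ ρ₂ : ℝ} (hY0 : 0 ≤ εY) (hεg : 0 ≤ εg) (hεh : 0 ≤ εh)
    (hsum : εY + εg + εh ≤ 1) (hκ1 : κ ≤ 1) (hq1 : 0 ≤ q₁) (hq2 : 0 ≤ q₂)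
    (hρ1 : 0 ≤ ρ₁) (hρ1' : ρ₁ ≤ κ * q₁) (hρ2 : 0 ≤ ρ₂) (hρ2' : ρ₂ ≤ κ * q₂) :
    0 ≤ (εY * (εg + κ * εh) * ((εg + κ * εh) - 2 * εg) + (1 - εY) * εg * (1 - εg)) * (q₁ * q₂) +
        (1 - εY) * εh * (1 - εh) * (ρ₁ * ρ₂) -
        εh * (εY * (εg + κ * εh) + (1 - εY) * εg) * (q₁ * ρ₂ + q₂ * ρ₁) := by
  -- the three corner constants
  set lam := εg + κ * εh with hlam
  set α := εY * lam * (lam - 2 * εg) + (1 - εY) * εg * (1 - εg) with hα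
  set β := (1 - εY) * εh * (1 - εh) with hβ
  set γ := εh * (εY * lam + (1 - εY) * εg) with hγ
  have hc : 0 ≤ 1 - εY - εg - εh := by linarith
  have hαnn : 0 ≤ α := by
    have e : α = εY * (lam - εg) ^ 2 + εg * (1 - εY - εg) := by rw [hα]; ring
    rw [e]; nlinarith [sq_nonneg (lam - εg), mul_nonneg hεg (by linarith : (0:ℝ) ≤ 1 - εY - εg)]
  have hαγ : 0 ≤ α - κ * γ := by
    have e : α - κ * γ = εg * (1 - εY - εg - κ * εh) := by rw [hα, hγ, hlam]; ring
    rw [e]; apply mul_nonneg hεg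
    nlinarith [mul_nonneg (sub_nonneg.2 hκ1) hεh]
  have hC : 0 ≤ α + β * κ ^ 2 - 2 * κ * γ := by
    have e : α + β * κ ^ 2 - 2 * κ * γ = εg * εh * (1 - κ) ^ 2 + (1 - εY - εg - εh) * (εg + κ ^ 2 * εh) - εY * 0 := by
      rw [hα, hβ, hγ, hlam]; ring
    rw [e]
    nlinarith [mul_nonneg (mul_nonneg hεg hεh) (sq_nonneg (1 - κ)), mul_nonneg hc (add_nonneg hεg (mul_nonneg (sq_nonneg κ) hεh))]
  -- write ρ_j = κ q_j − t_j, t_j ∈ [0, κ q_j]; F = C q₁q₂ + (γ − βκ)(q₁t₂ + q₂t₁) + β t₁t₂ ; minimise over the box via endpoints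
  have hβ0 : 0 ≤ β := by rw [hβ]; exact mul_nonneg (mul_nonneg (by linarith) hεh) (by linarith)
  obtain ⟨t₁, ht1⟩ : ∃ t, t = κ * q₁ - ρ₁ := ⟨_, rfl⟩
  obtain ⟨t₂, ht2⟩ : ∃ t, t = κ * q₂ - ρ₂ := ⟨_, rfl⟩
  have ht10 : 0 ≤ t₁ := by rw [ht1]; linarith
  have ht1T : t₁ ≤ κ * q₁ := by rw [ht1]; linarith
  have ht20 : 0 ≤ t₂ := by rw [ht2]; linarith
  have ht2T : t₂ ≤ κ * q₂ := by rw [ht2]; linarith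
  have hρ1e : ρ₁ = κ * q₁ - t₁ := by rw [ht1]; ring
  have hρ2e : ρ₂ = κ * q₂ - t₂ := by rw [ht2]; ring
  have key : (εY * (εg + κ * εh) * ((εg + κ * εh) - 2 * εg) + (1 - εY) * εg * (1 - εg)) * (q₁ * q₂) +
        (1 - εY) * εh * (1 - εh) * (ρ₁ * ρ₂) - εh * (εY * (εg + κ * εh) + (1 - εY) * εg) * (q₁ * ρ₂ + q₂ * ρ₁) =
      (α + β * κ ^ 2 - 2 * κ * γ) * (q₁ * q₂) + (γ - β * κ) * (q₁ * t₂ + q₂ * t₁) + β * (t₁ * t₂) := by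
    rw [hρ1e, hρ2e, hα, hβ, hγ, hlam]; ring
  rw [key]
  -- inner minimisation in t₁ (affine with slope (γ − βκ) q₂ + β t₂), then in t₂
  have step1 : min ((α + β * κ ^ 2 - 2 * κ * γ) * (q₁ * q₂) + (γ - β * κ) * (q₁ * t₂))
      ((α + β * κ ^ 2 - 2 * κ * γ) * (q₁ * q₂) + (γ - β * κ) * (q₁ * t₂) + ((γ - β * κ) * q₂ + β * t₂) * (κ * q₁)) ≤
      (α + β * κ ^ 2 - 2 * κ * γ) * (q₁ * q₂) + (γ - β * κ) * (q₁ * t₂ + q₂ * t₁) + β * (t₁ * t₂) := by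
    have := affine_ge_min_endpoints (m := (γ - β * κ) * q₂ + β * t₂)
      (b := (α + β * κ ^ 2 - 2 * κ * γ) * (q₁ * q₂) + (γ - β * κ) * (q₁ * t₂)) ht10 ht1T
    have e : (α + β * κ ^ 2 - 2 * κ * γ) * (q₁ * q₂) + (γ - β * κ) * (q₁ * t₂) + ((γ - β * κ) * q₂ + β * t₂) * t₁ =
        (α + β * κ ^ 2 - 2 * κ * γ) * (q₁ * q₂) + (γ - β * κ) * (q₁ * t₂ + q₂ * t₁) + β * (t₁ * t₂) := by ring
    rw [e] at this; exact this
  refine le_trans ?_ step1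
  apply le_min
  · -- t₁ = 0 :  C q₁q₂ + (γ − βκ) q₁ t₂ ≥ min over t₂ ∈ {0, κq₂} = min(C q₁q₂, (α − κγ) q₁q₂) ≥ 0
    have := affine_ge_min_endpoints (m := (γ - β * κ) * q₁) (b := (α + β * κ ^ 2 - 2 * κ * γ) * (q₁ * q₂)) ht20 ht2T
    have e1 : (α + β * κ ^ 2 - 2 * κ * γ) * (q₁ * q₂) + (γ - β * κ) * q₁ * (κ * q₂) = (α - κ * γ) * (q₁ * q₂) := by ring
    have e2 : (α + β * κ ^ 2 - 2 * κ * γ) * (q₁ * q₂) + (γ - β * κ) * q₁ * t₂ =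
        (α + β * κ ^ 2 - 2 * κ * γ) * (q₁ * q₂) + (γ - β * κ) * (q₁ * t₂) := by ring
    rw [e1, e2] at this
    refine le_trans (le_min ?_ ?_) this
    · exact mul_nonneg hC (mul_nonneg hq1 hq2)
    · exact mul_nonneg hαγ (mul_nonneg hq1 hq2)
  · -- t₁ = κ q₁ : value = (α − κγ) q₁q₂ + γ q₂ ... affine in t₂; endpoints t₂ = 0: (α−κγ)q₁q₂, t₂ = κq₂: α q₁q₂
    have := affine_ge_min_endpoints (m := (γ - β * κ) * q₁ + β * (κ * q₁)) (b := (α - κ * γ) * (q₁ * q₂)) ht20 ht2T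
    have e1 : (α - κ * γ) * (q₁ * q₂) + ((γ - β * κ) * q₁ + β * (κ * q₁)) * (κ * q₂) = α * (q₁ * q₂) := by ring
    have e2 : (α - κ * γ) * (q₁ * q₂) + ((γ - β * κ) * q₁ + β * (κ * q₁)) * t₂ =
        (α + β * κ ^ 2 - 2 * κ * γ) * (q₁ * q₂) + (γ - β * κ) * (q₁ * t₂) + ((γ - β * κ) * q₂ + β * t₂) * (κ * q₁) := by ring
    rw [e1, e2] at this
    refine le_trans (le_min ?_ ?_) this
    · exact mul_nonneg hαγ (mul_nonneg hq1 hq2)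
    · exact mul_nonneg hαnn (mul_nonneg hq1 hq2)

/-- **H_K for two petals.**  Two K-dominant, Ȳ-covered petals (`1 ≤ z_j ≤ k_j`, `1 ≤ r_j`, `r_j − 1 ≤ κ(k_j − 1)`,
`(ε_g+κε_h)(k_j−1) ≤ (1−ε_Y)(x_j−1)`) satisfy the ADDITIVE three-coin bound
`V₁V₂ ≤ c + ε_Y x₁x₂ + ε_g k₁k₂ + ε_h r₁r₂ = 1 + ε_Y(X−1) + ε_g(K−1) + ε_h(R−1)` — no leverage pot, no tying, no cap. [this work] -/
theorem classK_pair {c εY εg εh κ x₁ x₂ k₁ k₂ z₁ z₂ r₁ r₂ : ℝ}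
    (hsumeq : c + εY + εg + εh = 1) (hY0 : 0 < εY) (hY1 : εY < 1) (hεg : 0 ≤ εg) (hεh : 0 ≤ εh) (hc : 0 ≤ c)
    (hκ0 : 0 ≤ κ) (hκ1 : κ ≤ 1)
    (hz1 : 1 ≤ z₁) (hzk1 : z₁ ≤ k₁) (hr1 : 1 ≤ r₁) (hcl1 : r₁ - 1 ≤ κ * (k₁ - 1))
    (hA1 : (εg + κ * εh) * (k₁ - 1) ≤ (1 - εY) * (x₁ - 1))
    (hz2 : 1 ≤ z₂) (hzk2 : z₂ ≤ k₂) (hr2 : 1 ≤ r₂) (hcl2 : r₂ - 1 ≤ κ * (k₂ - 1))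
    (hA2 : (εg + κ * εh) * (k₂ - 1) ≤ (1 - εY) * (x₂ - 1)) :
    (c + εY * x₁ + εg * z₁ + εh * r₁) * (c + εY * x₂ + εg * z₂ + εh * r₂) ≤
      c + εY * (x₁ * x₂) + εg * (k₁ * k₂) + εh * (r₁ * r₂) := by
  have hsum : εY + εg + εh ≤ 1 := by linarith
  -- raise z_j to k_j (values increase, the right side does not see z)
  have hV2nn : 0 ≤ c + εY * x₂ + εg * z₂ + εh * r₂ := by
    have hx2 : 1 ≤ x₂ := by
      by_contra h; push Not at h
      have : (1 - εY) * (x₂ - 1) < 0 := mul_neg_of_pos_of_neg (by linarith) (by linarith)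
      nlinarith [mul_nonneg (add_nonneg hεg (mul_nonneg hκ0 hεh)) (by linarith : (0:ℝ) ≤ k₂ - 1)]
    nlinarith [mul_nonneg hY0.le (by linarith : (0:ℝ) ≤ x₂), mul_nonneg hεg (by linarith : (0:ℝ) ≤ z₂), mul_nonneg hεh (by linarith : (0:ℝ) ≤ r₂)]
  have hVk1nn : 0 ≤ c + εY * x₁ + εg * k₁ + εh * r₁ := by
    have hx1 : 1 ≤ x₁ := by
      by_contra h; push Not at h
      have : (1 - εY) * (x₁ - 1) < 0 := mul_neg_of_pos_of_neg (by linarith) (by linarith)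
      nlinarith [mul_nonneg (add_nonneg hεg (mul_nonneg hκ0 hεh)) (by linarith : (0:ℝ) ≤ k₁ - 1)]
    nlinarith [mul_nonneg hY0.le (by linarith : (0:ℝ) ≤ x₁), mul_nonneg hεg (by linarith : (0:ℝ) ≤ k₁), mul_nonneg hεh (by linarith : (0:ℝ) ≤ r₁)]
  have hmono : (c + εY * x₁ + εg * z₁ + εh * r₁) * (c + εY * x₂ + εg * z₂ + εh * r₂) ≤
      (c + εY * x₁ + εg * k₁ + εh * r₁) * (c + εY * x₂ + εg * k₂ + εh * r₂) := by
    have s1 : (c + εY * x₁ + εg * z₁ + εh * r₁) * (c + εY * x₂ + εg * z₂ + εh * r₂) ≤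
        (c + εY * x₁ + εg * k₁ + εh * r₁) * (c + εY * x₂ + εg * z₂ + εh * r₂) :=
      mul_le_mul_of_nonneg_right (by nlinarith [mul_le_mul_of_nonneg_left hzk1 hεg]) hV2nn
    have s2 : (c + εY * x₁ + εg * k₁ + εh * r₁) * (c + εY * x₂ + εg * z₂ + εh * r₂) ≤
        (c + εY * x₁ + εg * k₁ + εh * r₁) * (c + εY * x₂ + εg * k₂ + εh * r₂) :=
      mul_le_mul_of_nonneg_left (by nlinarith [mul_le_mul_of_nonneg_left hzk2 hεg]) hVk1nn
    exact s1.trans s2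
  refine hmono.trans ?_
  -- with z = k:  ε_Y (RHS − LHS) = B' ≥ B'_min = ε_Y · F/(1−ε_Y)-form; we use the affine reduction in a₁, a₂ explicitly
  obtain ⟨a₁, ha1⟩ : ∃ t, t = εY * (x₁ - 1) := ⟨_, rfl⟩
  obtain ⟨a₂, ha2⟩ : ∃ t, t = εY * (x₂ - 1) := ⟨_, rfl⟩
  obtain ⟨q₁, hq1⟩ : ∃ t, t = k₁ - 1 := ⟨_, rfl⟩
  obtain ⟨q₂, hq2⟩ : ∃ t, t = k₂ - 1 := ⟨_, rfl⟩
  obtain ⟨ρ₁, hρ1⟩ : ∃ t, t = r₁ - 1 := ⟨_, rfl⟩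
  obtain ⟨ρ₂, hρ2⟩ : ∃ t, t = r₂ - 1 := ⟨_, rfl⟩
  have hq1n : 0 ≤ q₁ := by rw [hq1]; linarith
  have hq2n : 0 ≤ q₂ := by rw [hq2]; linarith
  have hρ1n : 0 ≤ ρ₁ := by rw [hρ1]; linarith
  have hρ2n : 0 ≤ ρ₂ := by rw [hρ2]; linarith
  have hcc : c = 1 - εY - εg - εh := by linarith
  -- ε_Y (RHS − LHS) as the bilinear form B'
  have key : εY * ((c + εY * (x₁ * x₂) + εg * (k₁ * k₂) + εh * (r₁ * r₂)) -
      (c + εY * x₁ + εg * k₁ + εh * r₁) * (c + εY * x₂ + εg * k₂ + εh * r₂)) =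
      (1 - εY) * (a₁ * a₂) + εY * εg * (1 - εg) * (q₁ * q₂) + εY * εh * (1 - εh) * (ρ₁ * ρ₂)
        - εY * εg * (a₁ * q₂ + a₂ * q₁) - εY * εh * (a₁ * ρ₂ + a₂ * ρ₁) - εY * εg * εh * (q₁ * ρ₂ + q₂ * ρ₁) := by
    rw [hcc, ha1, ha2, hq1, hq2, hρ1, hρ2]; ring
  -- covers: (1−ε_Y) a_j ≥ ε_Y λ q_j  and class: ρ_j ≤ κ q_j
  have hcov1 : εY * (εg + κ * εh) * q₁ ≤ (1 - εY) * a₁ := by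
    have h := mul_le_mul_of_nonneg_left hA1 hY0.le
    have e1 : εY * ((εg + κ * εh) * (k₁ - 1)) = εY * (εg + κ * εh) * q₁ := by rw [hq1]; ring
    have e2 : εY * ((1 - εY) * (x₁ - 1)) = (1 - εY) * a₁ := by rw [ha1]; ring
    rw [e1, e2] at h; exact h
  have hcov2 : εY * (εg + κ * εh) * q₂ ≤ (1 - εY) * a₂ := by
    have h := mul_le_mul_of_nonneg_left hA2 hY0.le
    have e1 : εY * ((εg + κ * εh) * (k₂ - 1)) = εY * (εg + κ * εh) * q₂ := by rw [hq2]; ring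
    have e2 : εY * ((1 - εY) * (x₂ - 1)) = (1 - εY) * a₂ := by rw [ha2]; ring
    rw [e1, e2] at h; exact h
  have hcl1' : ρ₁ ≤ κ * q₁ := by rw [hρ1, hq1]; exact hcl1
  have hcl2' : ρ₂ ≤ κ * q₂ := by rw [hρ2, hq2]; exact hcl2
  -- slopes in a₁ and a₂ are ≥ 0, so reduce both covers to equality
  have hS2 : 0 ≤ (1 - εY) * a₂ - εY * εg * q₂ - εY * εh * ρ₂ := by
    have h := mul_le_mul_of_nonneg_left hcl2' (mul_nonneg hY0.le hεh)
    have e : εY * (εg + κ * εh) * q₂ = εY * εg * q₂ + εY * εh * (κ * q₂) := by ring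
    linarith
  have hS1 : 0 ≤ εY * εh * (κ * q₁ - ρ₁) := mul_nonneg (mul_nonneg hY0.le hεh) (by linarith)
  have hF := classK_reduced_nonneg hY0.le hεg hεh hsum hκ1 hq1n hq2n hρ1n hcl1' hρ2n hcl2'
  -- B'(a₁,a₂) ≥ B'(a₁min, a₂) ≥ B'(a₁min, a₂min) and (1−ε_Y)² B'(a₁min,a₂min) = ε_Y² (1−ε_Y)·… = ε_Y² F
  have hY1' : 0 < 1 - εY := by linarith
  have main : 0 ≤ (1 - εY) * (a₁ * a₂) + εY * εg * (1 - εg) * (q₁ * q₂) + εY * εh * (1 - εh) * (ρ₁ * ρ₂)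
        - εY * εg * (a₁ * q₂ + a₂ * q₁) - εY * εh * (a₁ * ρ₂ + a₂ * ρ₁) - εY * εg * εh * (q₁ * ρ₂ + q₂ * ρ₁) := by
    -- (1−ε_Y)·B' = ε_Y·F + d₁·S₂ + d₂·ε_Yε_h(κq₁−ρ₁), d_j = (1−ε_Y)a_j − ε_Yλq_j ≥ 0
    have hgain : (1 - εY) * ((1 - εY) * (a₁ * a₂) + εY * εg * (1 - εg) * (q₁ * q₂) + εY * εh * (1 - εh) * (ρ₁ * ρ₂)
        - εY * εg * (a₁ * q₂ + a₂ * q₁) - εY * εh * (a₁ * ρ₂ + a₂ * ρ₁) - εY * εg * εh * (q₁ * ρ₂ + q₂ * ρ₁)) =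
        εY * ((εY * (εg + κ * εh) * ((εg + κ * εh) - 2 * εg) + (1 - εY) * εg * (1 - εg)) * (q₁ * q₂) +
          (1 - εY) * εh * (1 - εh) * (ρ₁ * ρ₂) - εh * (εY * (εg + κ * εh) + (1 - εY) * εg) * (q₁ * ρ₂ + q₂ * ρ₁))
        + ((1 - εY) * a₁ - εY * (εg + κ * εh) * q₁) * ((1 - εY) * a₂ - εY * εg * q₂ - εY * εh * ρ₂)
        + ((1 - εY) * a₂ - εY * (εg + κ * εh) * q₂) * (εY * εh * (κ * q₁ - ρ₁)) := by ring
    have h1 : 0 ≤ ((1 - εY) * a₁ - εY * (εg + κ * εh) * q₁) * ((1 - εY) * a₂ - εY * εg * q₂ - εY * εh * ρ₂) :=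
      mul_nonneg (by linarith) hS2
    have h2 : 0 ≤ ((1 - εY) * a₂ - εY * (εg + κ * εh) * q₂) * (εY * εh * (κ * q₁ - ρ₁)) :=
      mul_nonneg (by linarith) hS1
    have h3 : 0 ≤ εY * ((εY * (εg + κ * εh) * ((εg + κ * εh) - 2 * εg) + (1 - εY) * εg * (1 - εg)) * (q₁ * q₂) +
          (1 - εY) * εh * (1 - εh) * (ρ₁ * ρ₂) - εh * (εY * (εg + κ * εh) + (1 - εY) * εg) * (q₁ * ρ₂ + q₂ * ρ₁)) :=
      mul_nonneg hY0.le hF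
    rw [← mul_nonneg_iff_of_pos_left hY1', hgain]
    linarith
  have hD : 0 ≤ (c + εY * (x₁ * x₂) + εg * (k₁ * k₂) + εh * (r₁ * r₂)) -
      (c + εY * x₁ + εg * k₁ + εh * r₁) * (c + εY * x₂ + εg * k₂ + εh * r₂) := by
    rw [← mul_nonneg_iff_of_pos_left hY0, key]; exact main
  linarith

end Summit.CriticalPhenomena.PercolationContinuityZ3.Theorems.SunflowerPartition.SafeCalc.LinkedCurrency
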